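import Mathlib
import Summits.Ventures.PercRepro2.A3BetweenCovariance
import Summits.Ventures.PercRepro2.A3FibreMain

/-!
# (MEANS-a₃) as a covariance inequality of conditional means — degenerate cases absorbed, and the
closure over all finite graphs (blind cell PercRepro2, typer-1 g16; part III on
`A3BetweenCovariance.lean`; p5 g12's `A3FibreMain.lean` for `A3Between_all`)

Unlike (HCOV), whose cleared form `Gc = D · P(Q) · G` vanishes when `D = 0`, the residual `btw` does
not trivialise on a null `PD`: it is then the `Q`-side covariance alone.  The identity of
`btw_eq_covariance` nevertheless holds for EVERY admissible weight vector (`btw_eq_covariance'`):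
on a null `PD` the `PD`-fibre masses and the conditioned measure `μ[|PD]` vanish on both sides, and
on a null `Q` everything does.  Hence

* **`A3Between_iff_covariance'`**: for every `p`, **(MEANS-a₃)** `A3Between` ⟺
  `P(PD) · cov[μ_PD[1_{b∈U} | 𝒢], μ_PD[1_{o∈U} | 𝒢]; μ_PD] ≤ P(Q) · cov[μ_Q[σ_b | 𝒢], μ_Q[F | 𝒢]; μ_Q]`;
* **`A3Between_all_iff_covariance`**: p5's closure `A3Between_all ℝ` (the binders of `HCov_all`) is
  the covariance inequality of the conditional means given the revealed cluster `C(a₃)` on every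
  finite graph, weight vector and marking — the means companion of `HCov_all_iff_covariance`.

A LANGUAGE line (an equivalence): the crux of record and the residual are unmoved.
-/

namespace Summit.Ventures.PercRepro2

open UnionCluster MeasureTheory ProbabilityTheory MeasureBridge

namespace CovForm

namespace A3Means

section All

variable {V : Type*} {E : Type*} [Fintype V] [DecidableEq V] [Fintype E] [DecidableEq E]

omit [Fintype V] [DecidableEq V] in
/-- On a null conditioning event every fibre mass vanishes. -/
lemma fibreExpect_eq_zero_of_prob_eq_zero {p : E → ℝ} (hp : IsProbVec p) (ends : E → Sym2 V)
    (a₃ : V) {A : Set (Config E)} (hA : prob p A = 0) (f : Config E → ℝ) (W : Finset V) :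
    fibreExpect p ends a₃ A f W = 0 :=
  expect_indicator_mul_eq_zero hp
    (le_antisymm ((prob_inter_le_left hp A _).trans hA.le) (prob_nonneg hp _)) f

/-- **(MEANS-a₃) as a covariance identity, every weight vector**: the identity of
`btw_eq_covariance` without the positivity hypotheses (on a null `PD` both `PD`-sides vanish, on a
null `Q` both sides vanish). -/
theorem btw_eq_covariance' (p : E → ℝ) (hp : IsProbVec p) (ends : E → Sym2 V)
    (o a₁ a₂ a₃ b : V) :
    A3Fibre.btw p ends o a₁ a₂ a₃ b =
      prob p (avoidAll ends a₂ {a₁}) *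
        cov[((percMeasureOf p hp)[|avoidAll ends a₂ {a₁}])[sigma ends a₁ a₂ b | clusterSigma ends a₃],
          ((percMeasureOf p hp)[|avoidAll ends a₂ {a₁}])[Ffun ends o a₁ a₂ a₃
            (gamma p ends o a₁ a₂ a₃) | clusterSigma ends a₃];
          (percMeasureOf p hp)[|avoidAll ends a₂ {a₁}]] -
      prob p (PDEvent ends a₁ a₂ a₃) *
        cov[((percMeasureOf p hp)[|PDEvent ends a₁ a₂ a₃])[inU ends a₁ a₂ b | clusterSigma ends a₃],
          ((percMeasureOf p hp)[|PDEvent ends a₁ a₂ a₃])[inU ends a₁ a₂ o | clusterSigma ends a₃];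
          (percMeasureOf p hp)[|PDEvent ends a₁ a₂ a₃]] := by
  by_cases hQ : prob p (avoidAll ends a₂ {a₁}) = 0
  · have hD : prob p (PDEvent ends a₁ a₂ a₃) = 0 :=
      le_antisymm ((D_le_PQ hp ends a₁ a₂ a₃).trans hQ.le) (prob_nonneg hp _)
    rw [covariance_cond_percMeasureOf_of_eq_zero p hp hQ,
      covariance_cond_percMeasureOf_of_eq_zero p hp hD]
    unfold A3Fibre.btw
    simp only [← fibreExpect_Q_sigma, ← fibreExpect_Q_F, ← fibreExpect_Q_inU,
      ← prob_Q_inter_clusterEvent]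
    simp [fibreExpect_eq_zero_of_prob_eq_zero hp ends a₃ hQ]
  · by_cases hD : prob p (PDEvent ends a₁ a₂ a₃) = 0
    · rw [covariance_cond_percMeasureOf_of_eq_zero p hp hD,
        covariance_congr_ae (condMean_ae_eq_condExp p hp ends a₃ _ _).symm
          (condMean_ae_eq_condExp p hp ends a₃ _ _).symm,
        covariance_cond_percMeasureOf p hp hQ, expect_indicator_condMean_mul,
        expect_indicator_condMean hp, expect_indicator_condMean hp]
      simp only [fibreExpect_Q_sigma, fibreExpect_Q_F, prob_Q_inter_clusterEvent]
      unfold A3Fibre.btw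
      rw [← sum_PD_mul, ← sum_PD_inU, ← sum_PD_inU]
      simp only [fibreExpect_eq_zero_of_prob_eq_zero hp ends a₃ hD, zero_div,
        Finset.sum_const_zero, sub_zero, add_zero, mul_zero]
      field_simp
    · exact btw_eq_covariance p hp ends o a₁ a₂ a₃ b hQ hD

/-- **(MEANS-a₃) in the language of conditional covariances, every weight vector**:
`A3Between ↔ P(PD) · cov[μ_PD[1_{b∈U} | 𝒢], μ_PD[1_{o∈U} | 𝒢]; μ_PD] ≤ P(Q) · cov[μ_Q[σ_b | 𝒢], μ_Q[F | 𝒢]; μ_Q]`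
(`𝒢 = σ(C(a₃))`, `μ_A = (percMeasureOf p hp)[|A]`), with no positivity hypothesis. -/
theorem A3Between_iff_covariance' (p : E → ℝ) (hp : IsProbVec p) (ends : E → Sym2 V)
    (o a₁ a₂ a₃ b : V) :
    A3Fibre.A3Between p ends o a₁ a₂ a₃ b ↔
      prob p (PDEvent ends a₁ a₂ a₃) *
          cov[((percMeasureOf p hp)[|PDEvent ends a₁ a₂ a₃])[inU ends a₁ a₂ b | clusterSigma ends a₃],
            ((percMeasureOf p hp)[|PDEvent ends a₁ a₂ a₃])[inU ends a₁ a₂ o | clusterSigma ends a₃];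
            (percMeasureOf p hp)[|PDEvent ends a₁ a₂ a₃]] ≤
        prob p (avoidAll ends a₂ {a₁}) *
          cov[((percMeasureOf p hp)[|avoidAll ends a₂ {a₁}])[sigma ends a₁ a₂ b |
              clusterSigma ends a₃],
            ((percMeasureOf p hp)[|avoidAll ends a₂ {a₁}])[Ffun ends o a₁ a₂ a₃
              (gamma p ends o a₁ a₂ a₃) | clusterSigma ends a₃];
            (percMeasureOf p hp)[|avoidAll ends a₂ {a₁}]] := by
  unfold A3Fibre.A3Between
  rw [btw_eq_covariance' p hp ends o a₁ a₂ a₃ b]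
  exact sub_nonneg

end All

/-- **(MEANS-a₃) on every finite graph as a covariance inequality of conditional means**:
p5's closure `A3Between_all ℝ` holds iff, on every finite graph, weight vector and marking,
`P(PD) · cov[μ_PD[1_{b∈U} | 𝒢], μ_PD[1_{o∈U} | 𝒢]; μ_PD] ≤ P(Q) · cov[μ_Q[σ_b | 𝒢], μ_Q[F | 𝒢]; μ_Q]`
with `𝒢 = σ(C(a₃))` the σ-algebra of the revealed cluster of `a₃` — the means companion of
`HCov_all_iff_covariance`. -/
theorem A3Between_all_iff_covariance :
    A3Fibre.A3Between_all ℝ ↔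
      ∀ (V E : Type) [Fintype V] [DecidableEq V] [Fintype E] [DecidableEq E]
        (ends : E → Sym2 V) (p : E → ℝ) (hp : IsProbVec p) (o a₁ a₂ a₃ b : V),
        a₁ ≠ a₂ → a₁ ≠ a₃ → a₂ ≠ a₃ → o ≠ a₁ → o ≠ a₂ → o ≠ a₃ → o ≠ b →
          b ≠ a₁ → b ≠ a₂ → b ≠ a₃ →
          prob p (PDEvent ends a₁ a₂ a₃) *
              cov[((percMeasureOf p hp)[|PDEvent ends a₁ a₂ a₃])[inU ends a₁ a₂ b |
                  clusterSigma ends a₃],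
                ((percMeasureOf p hp)[|PDEvent ends a₁ a₂ a₃])[inU ends a₁ a₂ o |
                  clusterSigma ends a₃];
                (percMeasureOf p hp)[|PDEvent ends a₁ a₂ a₃]] ≤
            prob p (avoidAll ends a₂ {a₁}) *
              cov[((percMeasureOf p hp)[|avoidAll ends a₂ {a₁}])[sigma ends a₁ a₂ b |
                  clusterSigma ends a₃],
                ((percMeasureOf p hp)[|avoidAll ends a₂ {a₁}])[Ffun ends o a₁ a₂ a₃
                  (gamma p ends o a₁ a₂ a₃) | clusterSigma ends a₃];
                (percMeasureOf p hp)[|avoidAll ends a₂ {a₁}]] := by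
  unfold A3Fibre.A3Between_all
  constructor
  · intro h V E _ _ _ _ ends p hp o a₁ a₂ a₃ b h1 h2 h3 h4 h5 h6 h7 h8 h9 h10
    exact (A3Between_iff_covariance' p hp ends o a₁ a₂ a₃ b).1
      (h V E ends p hp o a₁ a₂ a₃ b h1 h2 h3 h4 h5 h6 h7 h8 h9 h10)
  · intro h V E _ _ _ _ ends p hp o a₁ a₂ a₃ b h1 h2 h3 h4 h5 h6 h7 h8 h9 h10
    exact (A3Between_iff_covariance' p hp ends o a₁ a₂ a₃ b).2
      (h V E ends p hp o a₁ a₂ a₃ b h1 h2 h3 h4 h5 h6 h7 h8 h9 h10)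

end A3Means

end CovForm

end Summit.Ventures.PercRepro2
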